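import Mathlib
import Summits.KontsevichZagierPeriods.Zeta5Search.SorokinCensus.Generalized
import HarnessLib

/-!
HONEST FRAMING: systematic search; no irrationality claim unless certified.

# The generalized Sorokin family `J₅^gen` — Sigma (FAMILY.md §17; = Fischler's `𝒥(p)`, C. R. Math. 335 (2002) §3)

This module: `SigmaInvariance` PROVED (`sigmaInvariance_holds` via the measure-preserving involution `sigmaMap`) and the proved combinatorics of the maps `rev`/`σ`/`ψ₁` (`rev_raw_iff`, …, `balanced_iff_orbit`).

fam-sorokin gen 4 (planner-pub-zeta5-fam-sorokin-g4-0), staged `SorokinGeneralized.lean` v9 (sha256 e6bbed22…, 1570 l., filing request #2 FINAL-6 = last); split by the cell filing lane (lead/lit g11) at the gate's 400-line cap into `Generalized` (defs + statement nodes) → `GeneralizedSigma` → `GeneralizedMoves` → `GeneralizedEuler` → `GeneralizedReversalCoords` → `GeneralizedReversal` (linear import chain; mathematics verbatim, one-line docstrings added where missing, a private cube-measurability lemma duplicated across the split).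
Nothing here is an irrationality statement: elementary identities / calculus of absolutely convergent 5-fold integrals and integer bookkeeping.
-/

namespace Summit.KontsevichZagierPeriods.Zeta5Search.SorokinCensus

open Literature.NumberTheory.Irrationality.Zudilin2002 MeasureTheory Finset Set
open GenPoint

/-! ## Proof of `SigmaInvariance` (unconditional: the hypotheses are not used)

The coordinate involution `sigmaMap : (x₀,…,x₄) ↦ (x₀,x₁,x₂,1-x₄,1-x₃)` preserves Lebesgue measure and the cube, fixes
every continued product `tailQ x i`, `i ≤ 3` (they see `x₃,x₄` only through `x₃(1-x₄)`), and exchanges the monomial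
factors exactly as `GenPoint.sigma` exchanges the exponents. -/

/-- The involution `(x₃,x₄) ↦ (1-x₄,1-x₃)`. -/
def sigmaMap (x : Fin 5 → ℝ) : Fin 5 → ℝ :=
  fun j => if j = 3 then 1 - x 4 else if j = 4 then 1 - x 3 else x j

/-- `sigmaMap_apply_zero`: `(x : Fin 5 → ℝ) : sigmaMap x 0 = x 0`. -/
@[simp] theorem sigmaMap_apply_zero (x : Fin 5 → ℝ) : sigmaMap x 0 = x 0 := by simp [sigmaMap]
/-- `sigmaMap_apply_one` (simp lemma). -/
@[simp] theorem sigmaMap_apply_one (x : Fin 5 → ℝ) : sigmaMap x 1 = x 1 := by simp [sigmaMap]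
/-- `sigmaMap_apply_two` (simp lemma). -/
@[simp] theorem sigmaMap_apply_two (x : Fin 5 → ℝ) : sigmaMap x 2 = x 2 := by simp [sigmaMap]
/-- `sigmaMap_apply_three` (simp lemma). -/
@[simp] theorem sigmaMap_apply_three (x : Fin 5 → ℝ) : sigmaMap x 3 = 1 - x 4 := by simp [sigmaMap]
/-- `sigmaMap_apply_four` (simp lemma). -/
@[simp] theorem sigmaMap_apply_four (x : Fin 5 → ℝ) : sigmaMap x 4 = 1 - x 3 := by simp [sigmaMap]

/-- `tailQ_zero_eq`: `(x : Fin 5 → ℝ) : tailQ x 0 = 1 - x 0 * (1 - x 1 * (1 - x 2 * (1 - x 3 * (1 - x 4))))`. -/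
theorem tailQ_zero_eq (x : Fin 5 → ℝ) :
    tailQ x 0 = 1 - x 0 * (1 - x 1 * (1 - x 2 * (1 - x 3 * (1 - x 4)))) := by
  simp [tailQ, List.ofFn_succ, nestedQ]

/-- `tailQ_one_eq`: `(x : Fin 5 → ℝ) : tailQ x 1 = 1 - x 1 * (1 - x 2 * (1 - x 3 * (1 - x 4)))`. -/
theorem tailQ_one_eq (x : Fin 5 → ℝ) : tailQ x 1 = 1 - x 1 * (1 - x 2 * (1 - x 3 * (1 - x 4))) := by
  simp [tailQ, List.ofFn_succ, nestedQ]

/-- `tailQ_two_eq`: `(x : Fin 5 → ℝ) : tailQ x 2 = 1 - x 2 * (1 - x 3 * (1 - x 4))`. -/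
theorem tailQ_two_eq (x : Fin 5 → ℝ) : tailQ x 2 = 1 - x 2 * (1 - x 3 * (1 - x 4)) := by
  simp [tailQ, List.ofFn_succ, nestedQ, List.drop_succ_cons]

/-- `tailQ_three_eq`: `(x : Fin 5 → ℝ) : tailQ x 3 = 1 - x 3 * (1 - x 4)`. -/
theorem tailQ_three_eq (x : Fin 5 → ℝ) : tailQ x 3 = 1 - x 3 * (1 - x 4) := by
  simp [tailQ, List.ofFn_succ, nestedQ, List.drop_succ_cons]

/-- `tailQ_sigmaMap_zero`: `(x : Fin 5 → ℝ) : tailQ (sigmaMap x) 0 = tailQ x 0`. -/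
theorem tailQ_sigmaMap_zero (x : Fin 5 → ℝ) : tailQ (sigmaMap x) 0 = tailQ x 0 := by
  rw [tailQ_zero_eq, tailQ_zero_eq]; simp only [sigmaMap_apply_zero, sigmaMap_apply_one, sigmaMap_apply_two,
    sigmaMap_apply_three, sigmaMap_apply_four]; ring

/-- `tailQ_sigmaMap_one`: `(x : Fin 5 → ℝ) : tailQ (sigmaMap x) 1 = tailQ x 1`. -/
theorem tailQ_sigmaMap_one (x : Fin 5 → ℝ) : tailQ (sigmaMap x) 1 = tailQ x 1 := by
  rw [tailQ_one_eq, tailQ_one_eq]; simp only [sigmaMap_apply_one, sigmaMap_apply_two, sigmaMap_apply_three,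
    sigmaMap_apply_four]; ring

/-- `tailQ_sigmaMap_two`: `(x : Fin 5 → ℝ) : tailQ (sigmaMap x) 2 = tailQ x 2`. -/
theorem tailQ_sigmaMap_two (x : Fin 5 → ℝ) : tailQ (sigmaMap x) 2 = tailQ x 2 := by
  rw [tailQ_two_eq, tailQ_two_eq]; simp only [sigmaMap_apply_two, sigmaMap_apply_three, sigmaMap_apply_four]; ring

/-- `tailQ_sigmaMap_three`: `(x : Fin 5 → ℝ) : tailQ (sigmaMap x) 3 = tailQ x 3`. -/
theorem tailQ_sigmaMap_three (x : Fin 5 → ℝ) : tailQ (sigmaMap x) 3 = tailQ x 3 := by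
  rw [tailQ_three_eq, tailQ_three_eq]; simp only [sigmaMap_apply_three, sigmaMap_apply_four]; ring

/-- Pointwise: the `σ`-transformed integrand is the original integrand composed with `sigmaMap`. -/
theorem GenPoint.integrand_sigma (p : GenPoint) (x : Fin 5 → ℝ) :
    p.sigma.integrand x = p.integrand (sigmaMap x) := by
  simp only [GenPoint.integrand, tailQ_sigmaMap_zero, tailQ_sigmaMap_one, tailQ_sigmaMap_two,
    tailQ_sigmaMap_three, Fin.prod_univ_five]
  simp only [GenPoint.sigma, GenPoint.c, sigmaMap]
  simp only [Fin.isValue, show ((3 : Fin 5) = 4) = False by decide, show ((4 : Fin 5) = 3) = False by decide,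
    show ((0 : Fin 5) = 3) = False by decide, show ((0 : Fin 5) = 4) = False by decide,
    show ((1 : Fin 5) = 3) = False by decide, show ((1 : Fin 5) = 4) = False by decide,
    show ((2 : Fin 5) = 3) = False by decide, show ((2 : Fin 5) = 4) = False by decide,
    if_true, if_false, sub_sub_cancel]
  ring

/-- `sigmaMap_sigmaMap`: `(x : Fin 5 → ℝ) : sigmaMap (sigmaMap x) = x`. -/
theorem sigmaMap_sigmaMap (x : Fin 5 → ℝ) : sigmaMap (sigmaMap x) = x := by
  funext j
  fin_cases j <;> simp [sigmaMap]

/-- `measurable_sigmaMap`: `: Measurable sigmaMap`. -/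
theorem measurable_sigmaMap : Measurable sigmaMap := by
  refine measurable_pi_iff.mpr fun j => ?_
  fin_cases j <;> simp only [sigmaMap] <;> simp <;> fun_prop

/-- `sigmaMap` as a measurable equivalence (an involution). -/
def sigmaEquiv : (Fin 5 → ℝ) ≃ᵐ (Fin 5 → ℝ) where
  toFun := sigmaMap
  invFun := sigmaMap
  left_inv := sigmaMap_sigmaMap
  right_inv := sigmaMap_sigmaMap
  measurable_toFun := measurable_sigmaMap
  measurable_invFun := measurable_sigmaMap

/-- `sigmaMap` = (swap coordinates 3,4) ∘ (reflect coordinates 3,4), hence volume preserving. -/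
theorem measurePreserving_sigmaMap : MeasurePreserving sigmaMap volume volume := by
  let f : Fin 5 → ℝ → ℝ := fun i t => if i = 3 ∨ i = 4 then 1 - t else t
  have hf : ∀ i, MeasurePreserving (f i) volume volume := by
    intro i
    by_cases h : i = 3 ∨ i = 4
    · have : f i = fun t => 1 - t := by funext t; simp [f, h]
      rw [this]; exact Measure.measurePreserving_sub_left volume 1
    · have : f i = id := by funext t; simp [f, h]
      rw [this]; exact MeasurePreserving.id volume
  have hpi : MeasurePreserving (fun (a : Fin 5 → ℝ) (i : Fin 5) => f i (a i)) volume volume :=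
    volume_preserving_pi hf
  have hsw := volume_measurePreserving_piCongrLeft (fun _ : Fin 5 => ℝ) (Equiv.swap (3 : Fin 5) 4)
  have hcomp := hsw.comp hpi
  have hfun : (⇑(MeasurableEquiv.piCongrLeft (fun _ : Fin 5 => ℝ) (Equiv.swap (3 : Fin 5) 4)) ∘
      fun (a : Fin 5 → ℝ) (i : Fin 5) => f i (a i)) = sigmaMap := by
    funext x j
    simp only [Function.comp, MeasurableEquiv.coe_piCongrLeft, Equiv.piCongrLeft_apply, eq_rec_constant,
      Equiv.symm_swap]
    fin_cases j <;> simp [f, sigmaMap, Equiv.swap_apply_def]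
  rw [hfun] at hcomp
  exact hcomp

/-- `measurableSet_cube5`: `: MeasurableSet (cube 5)`. -/
private theorem measurableSet_cube5 : MeasurableSet (cube 5) :=
  MeasurableSet.univ_pi fun _ => measurableSet_Icc

/-- `sigmaMap_preimage_cube`: `: sigmaMap ⁻¹' cube 5 = cube 5`. -/
theorem sigmaMap_preimage_cube : sigmaMap ⁻¹' cube 5 = cube 5 := by
  ext x
  simp only [Set.mem_preimage, cube, Set.mem_univ_pi, Set.mem_Icc]
  constructor
  · intro h j
    have h3 := h 3; have h4 := h 4; have hj := h j
    fin_cases j <;> simp [sigmaMap] at h3 h4 hj ⊢ <;> constructor <;> linarith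
  · intro h j
    have h3 := h 3; have h4 := h 4; have hj := h j
    fin_cases j <;> simp [sigmaMap] at h3 h4 hj ⊢ <;> constructor <;> linarith

/-- THEOREM (PROVED): `SigmaInvariance` — `J(p) = J(σ p)` for every parameter point. -/
theorem GenPoint.J_sigma (p : GenPoint) : p.J = p.sigma.J := by
  have hemb : MeasurableEmbedding sigmaMap := sigmaEquiv.measurableEmbedding
  have key := measurePreserving_sigmaMap.setIntegral_preimage_emb hemb p.integrand (cube 5)
  rw [sigmaMap_preimage_cube] at key
  unfold GenPoint.J
  rw [← key]
  exact setIntegral_congr_fun measurableSet_cube5 fun x _ => (p.integrand_sigma x).symm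

/-- Integrability transfers under `σ` (both directions, `σ` being an involution). -/
theorem GenPoint.integrable_sigma_iff (p : GenPoint) : p.Integrable ↔ p.sigma.Integrable := by
  have hemb : MeasurableEmbedding sigmaMap := sigmaEquiv.measurableEmbedding
  have key := (measurePreserving_sigmaMap.integrableOn_comp_preimage hemb (f := p.integrand) (s := cube 5))
  rw [sigmaMap_preimage_cube] at key
  have hfun : p.integrand ∘ sigmaMap = p.sigma.integrand := funext fun x => (p.integrand_sigma x).symm
  rw [hfun] at key
  unfold GenPoint.Integrable
  exact key.symm

/-- `sigmaInvariance_holds`: `: SigmaInvariance`. -/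
theorem sigmaInvariance_holds : SigmaInvariance := fun p => ⟨p.J_sigma, p.integrable_sigma_iff⟩


/-! ## Combinatorics of the maps (proved): `rev` exchanges the locus `L^gen` with rawness and the cone `N^gen`
with `E = {e ≤ 0}`; `σ`, `ψ₁` are involutions; the balanced-pole predicate (iii) equals the orbit form (ii). -/

namespace GenPoint

/-- `E`: no inner factor in the denominator (`e₂, e₃, e₄ ≤ 0`). -/
def Eneg (p : GenPoint) : Prop := p.e 1 ≤ 0 ∧ p.e 2 ≤ 0 ∧ p.e 3 ≤ 0

/-- The ignored exponent slots are zero (normal form). -/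
def Normal (p : GenPoint) : Prop := p.e 0 = 0 ∧ p.e 4 = 0

/-- `rev_a₀`: `(p : GenPoint) : p.rev.a₀ = p.b 3 - p.c 4`. -/
@[simp] theorem rev_a₀ (p : GenPoint) : p.rev.a₀ = p.b 3 - p.c 4 := rfl
/-- `rev_a` (simp lemma). -/
@[simp] theorem rev_a (p : GenPoint) : p.rev.a = ![p.a 4, p.a 3, p.a 2, p.a 1, p.a 0] := rfl
/-- `rev_b` (simp lemma). -/
@[simp] theorem rev_b (p : GenPoint) :
    p.rev.b = ![p.a 4 + p.c 3, p.a 3 + p.c 2, p.a 2 + p.c 1, p.a 1 + p.c 0, p.b 0 + p.a 1 - p.a₀] := rfl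
/-- `rev_e`: `(p : GenPoint) : p.rev.e = ![0, (p.b 2 + p.e 3) - (p.c 3 + p.a 4), (p.b 1 + p.e 2) - (p.c 2 + p.a 3), (p.b …`. -/
@[simp] theorem rev_e (p : GenPoint) : p.rev.e =
    ![0, (p.b 2 + p.e 3) - (p.c 3 + p.a 4), (p.b 1 + p.e 2) - (p.c 2 + p.a 3), (p.b 0 + p.e 1) - (p.c 1 + p.a 2), 0] := rfl

/-- `rev p` is raw iff `p` lies on the generalized locus: `e'_{4-j} = T_j - T_{j+1}`. -/
theorem rev_raw_iff (p : GenPoint) : p.rev.Raw ↔ p.OnLgen := by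
  simp [Raw, OnLgen, T, GenPoint.c]
  omega

/-- `rev p ∈ E` iff `p ∈ N^gen`. -/
theorem rev_Eneg_iff (p : GenPoint) : p.rev.Eneg ↔ p.InNgen := by
  simp [Eneg, InNgen, T, GenPoint.c]
  omega

/-- `rev p ∈ N^gen` iff `p ∈ E`. -/
theorem rev_inNgen_iff (p : GenPoint) : p.rev.InNgen ↔ p.Eneg := by
  simp [Eneg, InNgen, T, GenPoint.c]
  omega

/-- `rev p` is on the locus iff `p` is raw. -/
theorem rev_onLgen_iff (p : GenPoint) : p.rev.OnLgen ↔ p.Raw := by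
  simp [Raw, OnLgen, T, GenPoint.c]
  omega

/-- `rev` is an involution on normal-form points. -/
theorem rev_rev (p : GenPoint) (h : p.Normal) : p.rev.rev = p := by
  rcases p with ⟨a₀, a, b, e⟩
  obtain ⟨h0, h4⟩ := h
  change e 0 = 0 at h0
  change e 4 = 0 at h4
  simp only [rev, GenPoint.c]
  congr 1
  · simp; omega
  · funext j; fin_cases j <;> simp
  · funext j; fin_cases j <;> simp; omega
  · funext j; fin_cases j <;> simp <;> omega

/-- `σ` is an involution. -/
theorem sigma_sigma (p : GenPoint) : p.sigma.sigma = p := by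
  rcases p with ⟨a₀, a, b, e⟩
  simp only [sigma, GenPoint.c]
  congr 1
  · funext j; fin_cases j <;> simp
  · funext j; fin_cases j <;> simp

/-- `ψ₁` is an involution. -/
theorem psi1_psi1 (p : GenPoint) : p.psi1.psi1 = p := by
  rcases p with ⟨a₀, a, b, e⟩
  simp only [psi1, GenPoint.c]
  congr 1
  · simp
  · funext j; fin_cases j <;> simp; omega
  · funext j; fin_cases j <;> simp; omega
  · funext j; fin_cases j <;> simp; omega

/-- Admissibility and convergence are preserved by `σ`. -/
theorem sigma_admissible (p : GenPoint) (h : p.Admissible) : p.sigma.Admissible := by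
  intro j
  have h0 := h 0; have h1 := h 1; have h2 := h 2; have h3 := h 3; have h4 := h 4
  fin_cases j <;> simp [sigma, GenPoint.c] <;> omega

/-- `sigma_converges`: `(p : GenPoint) (ha : p.Admissible) (h : p.Converges) : p.sigma.Converges`. -/
theorem sigma_converges (p : GenPoint) (ha : p.Admissible) (h : p.Converges) : p.sigma.Converges := by
  have h0 := ha 0; have h1 := ha 1; have h2 := ha 2; have h3 := ha 3; have h4 := ha 4
  simp only [Converges, sigma, GenPoint.c, Fin.isValue] at h ⊢
  simp
  omega

/-- BALANCED (iii) = ORBIT FORM (ii): `p` is balanced iff one of `p, ψ₁p, σp, ψ₁σp` lies in `N^gen ∩ E`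
(pure linear arithmetic; this is the equivalence FAMILY 17d checked on 144,416 points, now a theorem for all
admissible integer points). -/
theorem balanced_iff_orbit (p : GenPoint) (ha : p.Admissible) :
    p.Balanced ↔ ((p.InNgen ∧ p.Eneg) ∨ (p.psi1.InNgen ∧ p.psi1.Eneg) ∨ (p.sigma.InNgen ∧ p.sigma.Eneg) ∨
      (p.sigma.psi1.InNgen ∧ p.sigma.psi1.Eneg)) := by
  have h0 := ha 0; have h1 := ha 1; have h2 := ha 2; have h3 := ha 3; have h4 := ha 4
  simp [Balanced, InNgen, Eneg, T, psi1, sigma, GenPoint.c]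
  omega

end GenPoint

/-- The landed v2 node `SigmaIdentity` (with its unused hypotheses) follows from `SigmaInvariance`. -/
theorem sigmaIdentity_holds : SigmaIdentity := fun p _ _ => (sigmaInvariance_holds p).1

end Summit.KontsevichZagierPeriods.Zeta5Search.SorokinCensus
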